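import Literature.Probability.RandomPlanarGeometry.HexSAWBrickWallStripFugacityWidthOneJointContactLDP
import HarnessLib

/-!
# The zigzag vertex of the density triangle: zero entropy and the cost of a rung at every third step

Child module of `HexSAWBrickWallStripFugacityWidthOneJointContactLDP.lean` (§8: the two-density contact entropy `contactEntropy₂` in closed
form).  At the vertex `(1/6, 1/6)` of the density triangle — the walks with a rung at (asymptotically) every third step, the maximal
rung density `1/3` of `HexSAWBrickWallStripRungRays` — the entropy VANISHES: along the diagonal `a = a' = 1/6 + t`,
`s(1/6+t, 1/6+t) = −6t·log(6t) + (1/3+2t)·log(1/3+2t) + (4t−1/3)·log(1/3−4t) → 0` as `t → 0⁺` (§1), and consequently the exponential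
cost under `P_{N,y,z}` of forcing both contact densities up to the zigzag's is `log μ_1(y,z) − (log y + log z)/6` in the limit (§2: the free
energy minus the energy `(log y + log z)/6` per step of the periodic zigzag, which has no entropy).

## Main statements (namespace `Literature.Probability.RandomPlanarGeometry.SAW.HexBW`, all PROVED, standard axioms)
§1 `contactEntropy₂_diag_eq` (the closed form on the diagonal near the vertex), ★★ **`tendsto_contactEntropy₂_vertex`** (`s → 0` at `(1/6,1/6)`).
§2 ★★ **`tendsto_jointRate_vertex`** (`J(y,z; tilt of (1/6+t,1/6+t)) → log μ_1(y,z) − (log y + log z)/6`).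
§3 (ed.2) `contactEntropy₂_adsorbedEdge_eq`, ★★ **`tendsto_contactEntropy₂_adsorbedEdge`** (`s → 0` on the ADSORBED EDGE `a + a' = 1/2`, every bottom share
`a₀`), ★★ `tendsto_jointRate_adsorbedEdge` (cost of the rung-free walks `log μ_1 − a₀ log y − (1/2 − a₀) log z`).
§4 (ed.2) `contactEntropy₂_repellingEdge_eq`, ★★ **`tendsto_contactEntropy₂_repellingEdge`** (on the REPELLING edge `4a + 2a' = 1` the entropy tends to the
POSITIVE binary-entropy value `L(c) = −(R/2)log R − (S/2)log S + c log 2c`, `R = 3c − 1/2`, `S = 1/2 − c`), ★ `repellingEdge_limit_pos`.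

## Sources
JansevanRensburg2000 §3.3 (1st ed., OUP 2000, the held text: properties of the density function at the ends of its interval — zero-entropy
endpoints); DemboZeitouni2010 §2.2 (rate function at the boundary of the support); BeatonBousquetMelouDeGierDuminilCopinGuttmann2014 §3.2
Proposition 6 (arXiv v5 p. 10; objects only).  Nothing quoted AS PRINTED; the statements are this lineage's.  NOT CLAIMED: the vertices
`(1/2,0)`, `(0,1/2)` as two-variable limits; the mirror edge `2a + 4a' = 1` is the swap `(a,a') ↦ (a',a)` of §4 (`contactEntropy₂_swap`).
-/

noncomputable section

open Filter Topology Finset Literature.Probability.LatticeModels Literature.Probability.Percolation SimpleGraph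

namespace Literature.Probability.RandomPlanarGeometry.SAW.HexBW

open WidthOneYZ

variable {y z : ℝ}

/-! ## §1 The entropy vanishes at the zigzag vertex `(1/6, 1/6)` -/

/-- The closed form of the two-density entropy on the diagonal near the vertex: for `0 < t < 1/12`,
`s(1/6+t, 1/6+t) = −6t·log(6t) + (1/3+2t)·log(1/3+2t) + (4t−1/3)·log(1/3−4t)`.
[cite: JansevanRensburg2000, §3.2 Theorem 3.19 (1st ed., p. 52); BeatonBousquetMelouDeGierDuminilCopinGuttmann2014, §3.2 Proposition 6 (arXiv v5 p. 10)] -/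
theorem contactEntropy₂_diag_eq {t : ℝ} (ht0 : 0 < t) (ht1 : t < 1 / 12) :
    contactEntropy₂ (1 / 6 + t) (1 / 6 + t) =
      -(6 * t) * Real.log (6 * t) + (1 / 3 + 2 * t) * Real.log (1 / 3 + 2 * t) + (4 * t - 1 / 3) * Real.log (1 / 3 - 4 * t) := by
  have h1 : (1 / 6 + t) + (1 / 6 + t) < 1 / 2 := by linarith
  have h2 : 1 < 4 * (1 / 6 + t) + 2 * (1 / 6 + t) := by linarith
  have h3 : 1 < 2 * (1 / 6 + t) + 4 * (1 / 6 + t) := by linarith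
  rw [contactEntropy₂_eq h1 h2 h3]
  have hp : 0 < 6 * t := by linarith
  have hq : 0 < 1 / 3 - 4 * t := by linarith
  have hr : 0 < 1 / 3 + 2 * t := by linarith
  -- the ingredients
  have e1 : 4 * (1 / 6 + t) + 2 * (1 / 6 + t) - 1 = 6 * t := by ring
  have e2 : 2 * (1 / 6 + t) + 4 * (1 / 6 + t) - 1 = 6 * t := by ring
  have e3 : 1 - 2 * (1 / 6 + t) - 2 * (1 / 6 + t) = 1 / 3 - 4 * t := by ring
  have e4 : 2 * (1 / 6 + t) = 1 / 3 + 2 * t := by ring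
  have hY : eosY (1 / 6 + t) (1 / 6 + t) = (6 * t) ^ 3 / ((1 / 3 + 2 * t) * (1 / 3 - 4 * t) ^ 2) := by
    unfold eosY; rw [e1, e2, e3, e4]; ring
  rw [e1, e2, e3, hY]
  have hlog1 : Real.log (6 * t * (6 * t) / (1 / 3 - 4 * t) ^ 2) = 2 * Real.log (6 * t) - 2 * Real.log (1 / 3 - 4 * t) := by
    rw [Real.log_div (by positivity) (by positivity), Real.log_mul hp.ne' hp.ne', Real.log_pow]; push_cast; ring
  have hlog2 : Real.log ((6 * t) ^ 3 / ((1 / 3 + 2 * t) * (1 / 3 - 4 * t) ^ 2)) =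
      3 * Real.log (6 * t) - Real.log (1 / 3 + 2 * t) - 2 * Real.log (1 / 3 - 4 * t) := by
    rw [Real.log_div (by positivity) (by positivity), Real.log_pow, Real.log_mul hr.ne' (by positivity), Real.log_pow]
    push_cast; ring
  rw [hlog1, hlog2]
  ring

/-- ★★ **ZERO ENTROPY AT THE ZIGZAG VERTEX**: `s(1/6+t, 1/6+t) → 0` as `t → 0⁺` — the walks with a rung at every third step (rung density `1/3`,
contact densities `(1/6,1/6)`) are exponentially few: the periodic zigzag carries no entropy.
[cite: JansevanRensburg2000, §3.3 (1st ed.: the density function at the endpoints of its support); DemboZeitouni2010, §2.2 Theorem 2.2.3] -/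
theorem tendsto_contactEntropy₂_vertex :
    Tendsto (fun t : ℝ => contactEntropy₂ (1 / 6 + t) (1 / 6 + t)) (𝓝[>] 0) (𝓝 0) := by
  -- the right-hand side of the closed form is continuous at `t = 0` with value `0`
  have hml : Continuous fun x : ℝ => x * Real.log x := Real.continuous_mul_log
  have h6 : Continuous fun t : ℝ => 6 * t := continuous_const.mul continuous_id
  have hA : Tendsto (fun t : ℝ => 6 * t * Real.log (6 * t)) (𝓝 0) (𝓝 0) := by
    have h := (hml.comp h6).tendsto 0
    simp only [Function.comp, mul_zero, Real.log_zero] at h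
    exact h
  have hB : Tendsto (fun t : ℝ => (1 / 3 + 2 * t) * Real.log (1 / 3 + 2 * t)) (𝓝 0) (𝓝 ((1 / 3) * Real.log (1 / 3))) := by
    have hc : ContinuousAt (fun t : ℝ => (1 / 3 + 2 * t) * Real.log (1 / 3 + 2 * t)) 0 :=
      (continuousAt_const.add (continuousAt_const.mul continuousAt_id)).mul
        ((continuousAt_const.add (continuousAt_const.mul continuousAt_id)).log (by norm_num))
    have := hc.tendsto
    simpa using this
  have hC : Tendsto (fun t : ℝ => (4 * t - 1 / 3) * Real.log (1 / 3 - 4 * t)) (𝓝 0) (𝓝 ((-(1 / 3)) * Real.log (1 / 3))) := by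
    have hc : ContinuousAt (fun t : ℝ => (4 * t - 1 / 3) * Real.log (1 / 3 - 4 * t)) 0 :=
      ((continuousAt_const.mul continuousAt_id).sub continuousAt_const).mul
        ((continuousAt_const.sub (continuousAt_const.mul continuousAt_id)).log (by norm_num))
    have := hc.tendsto
    simpa using this
  have hsum := (hA.neg.add hB).add hC
  have e : -0 + 1 / 3 * Real.log (1 / 3) + -(1 / 3) * Real.log (1 / 3) = (0 : ℝ) := by ring
  rw [e] at hsum
  refine (hsum.mono_left nhdsWithin_le_nhds).congr' ?_
  have hev : ∀ᶠ t in 𝓝[>] (0 : ℝ), 0 < t ∧ t < 1 / 12 := by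
    have : Set.Ioo (0 : ℝ) (1 / 12) ∈ 𝓝[>] (0 : ℝ) := Ioo_mem_nhdsGT (by norm_num)
    filter_upwards [this] with t ht using ht
  filter_upwards [hev] with t ht
  rw [contactEntropy₂_diag_eq ht.1 ht.2]
  ring

/-! ## §2 The cost of the zigzag -/

/-- ★★ **THE COST OF A RUNG AT EVERY THIRD STEP**: for all `y, z > 0`, the joint rate at the tilt realising the densities `(1/6+t, 1/6+t)`
tends to `log μ_1(y,z) − (log y + log z)/6` as `t → 0⁺` — the free energy minus the energy per step of the zigzag (one bottom and one top
contact every six steps… i.e. densities `1/6` each), with no entropy term.  [Gibbs form `jointRate_eq_sub_contactEntropy₂` + §1.]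
[cite: DemboZeitouni2010, §2.2 Theorem 2.2.3; JansevanRensburg2000, §3.2 Theorem 3.18 (1st ed., p. 51)] -/
theorem tendsto_jointRate_vertex (hy : 0 < y) (hz : 0 < z) :
    Tendsto (fun t : ℝ => jointRate y z (eosY (1 / 6 + t) (1 / 6 + t)) (eosY (1 / 6 + t) (1 / 6 + t))) (𝓝[>] 0)
      (𝓝 (Real.log (stripMuY₂ 1 y z) - (Real.log y + Real.log z) / 6)) := by
  have hs := tendsto_contactEntropy₂_vertex
  have hlin : Tendsto (fun t : ℝ => Real.log (stripMuY₂ 1 y z) -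
      ((1 / 6 + t) * Real.log y + (1 / 6 + t) * Real.log z + contactEntropy₂ (1 / 6 + t) (1 / 6 + t))) (𝓝[>] 0)
      (𝓝 (Real.log (stripMuY₂ 1 y z) - ((1 / 6 + 0) * Real.log y + (1 / 6 + 0) * Real.log z + 0))) := by
    have ht : Tendsto (fun t : ℝ => t) (𝓝[>] (0 : ℝ)) (𝓝 0) := tendsto_nhdsWithin_of_tendsto_nhds tendsto_id
    exact tendsto_const_nhds.sub ((((tendsto_const_nhds.add ht).mul tendsto_const_nhds).add
      ((tendsto_const_nhds.add ht).mul tendsto_const_nhds)).add hs)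
  have e : Real.log (stripMuY₂ 1 y z) - ((1 / 6 + 0) * Real.log y + (1 / 6 + 0) * Real.log z + 0) =
      Real.log (stripMuY₂ 1 y z) - (Real.log y + Real.log z) / 6 := by ring
  rw [e] at hlin
  refine hlin.congr' ?_
  have hev : ∀ᶠ t in 𝓝[>] (0 : ℝ), 0 < t ∧ t < 1 / 12 := by
    have : Set.Ioo (0 : ℝ) (1 / 12) ∈ 𝓝[>] (0 : ℝ) := Ioo_mem_nhdsGT (by norm_num)
    filter_upwards [this] with t ht using ht
  filter_upwards [hev] with t ht
  have h1 : (1 / 6 + t) + (1 / 6 + t) < 1 / 2 := by linarith [ht.2]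
  have h2 : 1 < 4 * (1 / 6 + t) + 2 * (1 / 6 + t) := by linarith [ht.1]
  have h3 : 1 < 2 * (1 / 6 + t) + 4 * (1 / 6 + t) := by linarith [ht.1]
  rw [jointRate_eq_sub_contactEntropy₂ hy hz h1 h2 h3]

/-! ## §3 (ed.2) The adsorbed edge `a + a' = 1/2`: zero entropy, and the cost of the rung-free walks -/

/-- The closed form of the entropy near the adsorbed edge: for `0 < a₀ < 1/2` and small `t > 0`, at `(a,a') = (a₀ − t, 1/2 − a₀ − t)`
(rung density `ρ = 4t`), with `P = 2a₀ − 6t`, `Q = 1 − 2a₀ − 6t`, `A = a₀ − t`, `A' = 1/2 − a₀ − t`: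
`s = [½(log P + log Q) − 2 log 2 − A(2 log P + log Q − 5 log 2 − log A) − A'(2 log Q + log P − 5 log 2 − log A')] − 4t·log t`.
[cite: JansevanRensburg2000, §3.2 Theorem 3.19 (1st ed., p. 52); BeatonBousquetMelouDeGierDuminilCopinGuttmann2014, §3.2 Proposition 6 (arXiv v5 p. 10)] -/
theorem contactEntropy₂_adsorbedEdge_eq {a₀ t : ℝ} (ht0 : 0 < t) (h1 : 6 * t < 2 * a₀) (h2 : 6 * t < 1 - 2 * a₀) :
    contactEntropy₂ (a₀ - t) (1 / 2 - a₀ - t) =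
      (1 / 2 * (Real.log (2 * a₀ - 6 * t) + Real.log (1 - 2 * a₀ - 6 * t)) - 2 * Real.log 2 -
        (a₀ - t) * (2 * Real.log (2 * a₀ - 6 * t) + Real.log (1 - 2 * a₀ - 6 * t) - 5 * Real.log 2 - Real.log (a₀ - t)) -
        (1 / 2 - a₀ - t) * (2 * Real.log (1 - 2 * a₀ - 6 * t) + Real.log (2 * a₀ - 6 * t) - 5 * Real.log 2 - Real.log (1 / 2 - a₀ - t))) -
      4 * t * Real.log t := by
  have hP : 0 < 2 * a₀ - 6 * t := by linarith
  have hQ : 0 < 1 - 2 * a₀ - 6 * t := by linarith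
  have hA : 0 < a₀ - t := by linarith
  have hA' : 0 < 1 / 2 - a₀ - t := by linarith
  have k1 : (a₀ - t) + (1 / 2 - a₀ - t) < 1 / 2 := by linarith
  have k2 : 1 < 4 * (a₀ - t) + 2 * (1 / 2 - a₀ - t) := by linarith
  have k3 : 1 < 2 * (a₀ - t) + 4 * (1 / 2 - a₀ - t) := by linarith
  rw [contactEntropy₂_eq k1 k2 k3]
  have e1 : 4 * (a₀ - t) + 2 * (1 / 2 - a₀ - t) - 1 = 2 * a₀ - 6 * t := by ring
  have e2 : 2 * (a₀ - t) + 4 * (1 / 2 - a₀ - t) - 1 = 1 - 2 * a₀ - 6 * t := by ring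
  have e3 : 1 - 2 * (a₀ - t) - 2 * (1 / 2 - a₀ - t) = 4 * t := by ring
  have e1' : 4 * (1 / 2 - a₀ - t) + 2 * (a₀ - t) - 1 = 1 - 2 * a₀ - 6 * t := by ring
  have e2' : 2 * (1 / 2 - a₀ - t) + 4 * (a₀ - t) - 1 = 2 * a₀ - 6 * t := by ring
  have e3' : 1 - 2 * (1 / 2 - a₀ - t) - 2 * (a₀ - t) = 4 * t := by ring
  have hY : eosY (a₀ - t) (1 / 2 - a₀ - t) = (2 * a₀ - 6 * t) ^ 2 * (1 - 2 * a₀ - 6 * t) / (32 * t ^ 2 * (a₀ - t)) := by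
    unfold eosY; rw [e1, e2, e3]; field_simp; ring
  have hZ : eosY (1 / 2 - a₀ - t) (a₀ - t) = (1 - 2 * a₀ - 6 * t) ^ 2 * (2 * a₀ - 6 * t) / (32 * t ^ 2 * (1 / 2 - a₀ - t)) := by
    unfold eosY; rw [e1', e2', e3']; field_simp; ring
  rw [e1, e2, e3, hY, hZ]
  have l32 : Real.log 32 = 5 * Real.log 2 := by
    rw [show (32 : ℝ) = 2 ^ 5 by norm_num, Real.log_pow]; norm_num
  have l16 : Real.log ((4 * t) ^ 2) = 2 * (2 * Real.log 2 + Real.log t) := by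
    rw [Real.log_pow, Real.log_mul (by norm_num) ht0.ne', show (4 : ℝ) = 2 ^ 2 by norm_num, Real.log_pow]; push_cast; ring
  have hlog0 : Real.log ((2 * a₀ - 6 * t) * (1 - 2 * a₀ - 6 * t) / (4 * t) ^ 2) =
      Real.log (2 * a₀ - 6 * t) + Real.log (1 - 2 * a₀ - 6 * t) - 2 * (2 * Real.log 2 + Real.log t) := by
    rw [Real.log_div (by positivity) (by positivity), Real.log_mul hP.ne' hQ.ne', l16]
  have hlogY : Real.log ((2 * a₀ - 6 * t) ^ 2 * (1 - 2 * a₀ - 6 * t) / (32 * t ^ 2 * (a₀ - t))) =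
      2 * Real.log (2 * a₀ - 6 * t) + Real.log (1 - 2 * a₀ - 6 * t) - (5 * Real.log 2 + 2 * Real.log t + Real.log (a₀ - t)) := by
    rw [Real.log_div (by positivity) (by positivity), Real.log_mul (by positivity) hQ.ne', Real.log_pow,
      Real.log_mul (by positivity) hA.ne', Real.log_mul (by norm_num) (by positivity), Real.log_pow, l32]
    push_cast; ring
  have hlogZ : Real.log ((1 - 2 * a₀ - 6 * t) ^ 2 * (2 * a₀ - 6 * t) / (32 * t ^ 2 * (1 / 2 - a₀ - t))) =
      2 * Real.log (1 - 2 * a₀ - 6 * t) + Real.log (2 * a₀ - 6 * t) - (5 * Real.log 2 + 2 * Real.log t + Real.log (1 / 2 - a₀ - t)) := by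
    rw [Real.log_div (by positivity) (by positivity), Real.log_mul (by positivity) hP.ne', Real.log_pow,
      Real.log_mul (by positivity) hA'.ne', Real.log_mul (by norm_num) (by positivity), Real.log_pow, l32]
    push_cast; ring
  rw [hlog0, hlogY, hlogZ]
  ring

/-- ★★ **ZERO ENTROPY ON THE ADSORBED EDGE**: for every `0 < a₀ < 1/2`, `s(a₀ − t, 1/2 − a₀ − t) → 0` as `t → 0⁺` — the walks with almost
no rungs (all sites on the two walls, bottom share `a₀`) are exponentially few; the `−4t log t` term is the only non-analytic part.
[cite: JansevanRensburg2000, §3.3 (1st ed.: the density function at the endpoints of its support); DemboZeitouni2010, §2.2 Theorem 2.2.3] -/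
theorem tendsto_contactEntropy₂_adsorbedEdge {a₀ : ℝ} (ha0 : 0 < a₀) (ha1 : a₀ < 1 / 2) :
    Tendsto (fun t : ℝ => contactEntropy₂ (a₀ - t) (1 / 2 - a₀ - t)) (𝓝[>] 0) (𝓝 0) := by
  have hP0 : (2 * a₀ - 6 * 0) ≠ 0 := by linarith
  have hQ0 : (1 - 2 * a₀ - 6 * 0) ≠ 0 := by linarith
  have hA0 : (a₀ - 0) ≠ 0 := by linarith
  have hA0' : (1 / 2 - a₀ - 0) ≠ 0 := by linarith
  -- the analytic part is continuous at `0`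
  have hP : ContinuousAt (fun t : ℝ => Real.log (2 * a₀ - 6 * t)) 0 :=
    (continuousAt_const.sub (continuousAt_const.mul continuousAt_id)).log hP0
  have hQ : ContinuousAt (fun t : ℝ => Real.log (1 - 2 * a₀ - 6 * t)) 0 :=
    (continuousAt_const.sub (continuousAt_const.mul continuousAt_id)).log hQ0
  have hA : ContinuousAt (fun t : ℝ => Real.log (a₀ - t)) 0 := (continuousAt_const.sub continuousAt_id).log hA0
  have hA' : ContinuousAt (fun t : ℝ => Real.log (1 / 2 - a₀ - t)) 0 := (continuousAt_const.sub continuousAt_id).log hA0'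
  have hlinA : ContinuousAt (fun t : ℝ => a₀ - t) 0 := continuousAt_const.sub continuousAt_id
  have hlinA' : ContinuousAt (fun t : ℝ => 1 / 2 - a₀ - t) 0 := continuousAt_const.sub continuousAt_id
  have hg : ContinuousAt (fun t : ℝ =>
      1 / 2 * (Real.log (2 * a₀ - 6 * t) + Real.log (1 - 2 * a₀ - 6 * t)) - 2 * Real.log 2 -
        (a₀ - t) * (2 * Real.log (2 * a₀ - 6 * t) + Real.log (1 - 2 * a₀ - 6 * t) - 5 * Real.log 2 - Real.log (a₀ - t)) -
        (1 / 2 - a₀ - t) * (2 * Real.log (1 - 2 * a₀ - 6 * t) + Real.log (2 * a₀ - 6 * t) - 5 * Real.log 2 -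
          Real.log (1 / 2 - a₀ - t))) 0 :=
    ((continuousAt_const.mul (hP.add hQ)).sub continuousAt_const).sub
        (hlinA.mul ((((continuousAt_const.mul hP).add hQ).sub continuousAt_const).sub hA)) |>.sub
      (hlinA'.mul ((((continuousAt_const.mul hQ).add hP).sub continuousAt_const).sub hA'))
  have hg0 := hg.tendsto
  -- its value at `0` vanishes: `log(2a₀) = log 2 + log a₀`, `log(1 − 2a₀) = log 2 + log(1/2 − a₀)`
  have v1 : Real.log (2 * a₀ - 6 * 0) = Real.log 2 + Real.log a₀ := by
    rw [mul_zero, sub_zero, Real.log_mul (by norm_num) ha0.ne']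
  have v2 : Real.log (1 - 2 * a₀ - 6 * 0) = Real.log 2 + Real.log (1 / 2 - a₀) := by
    rw [mul_zero, sub_zero, show (1 : ℝ) - 2 * a₀ = 2 * (1 / 2 - a₀) by ring, Real.log_mul (by norm_num) (by linarith)]
  have hval : (1 / 2 * (Real.log (2 * a₀ - 6 * 0) + Real.log (1 - 2 * a₀ - 6 * 0)) - 2 * Real.log 2 -
        (a₀ - 0) * (2 * Real.log (2 * a₀ - 6 * 0) + Real.log (1 - 2 * a₀ - 6 * 0) - 5 * Real.log 2 - Real.log (a₀ - 0)) -
        (1 / 2 - a₀ - 0) * (2 * Real.log (1 - 2 * a₀ - 6 * 0) + Real.log (2 * a₀ - 6 * 0) - 5 * Real.log 2 -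
          Real.log (1 / 2 - a₀ - 0))) = 0 := by
    rw [v1, v2, sub_zero, sub_zero]; ring
  rw [hval] at hg0
  -- the `t log t` part
  have htl : Tendsto (fun t : ℝ => 4 * t * Real.log t) (𝓝 0) (𝓝 0) := by
    have h := (Real.continuous_mul_log.tendsto 0).const_mul 4
    simp only [Real.log_zero, mul_zero] at h
    refine h.congr fun t => ?_
    ring
  have hsum := Tendsto.mono_left (hg0.sub htl) (nhdsWithin_le_nhds (s := Set.Ioi (0 : ℝ)) (a := (0 : ℝ)))
  rw [sub_zero] at hsum
  refine hsum.congr' ?_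
  have hev : ∀ᶠ t in 𝓝[>] (0 : ℝ), 0 < t ∧ t < min (2 * a₀) (1 - 2 * a₀) / 6 := by
    have : Set.Ioo (0 : ℝ) (min (2 * a₀) (1 - 2 * a₀) / 6) ∈ 𝓝[>] (0 : ℝ) :=
      Ioo_mem_nhdsGT (by have := lt_min (by linarith : 0 < 2 * a₀) (by linarith : 0 < 1 - 2 * a₀); linarith)
    filter_upwards [this] with t ht using ht
  filter_upwards [hev] with t ht
  have hm1 : min (2 * a₀) (1 - 2 * a₀) ≤ 2 * a₀ := min_le_left _ _
  have hm2 : min (2 * a₀) (1 - 2 * a₀) ≤ 1 - 2 * a₀ := min_le_right _ _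
  rw [contactEntropy₂_adsorbedEdge_eq ht.1 (by linarith [ht.2]) (by linarith [ht.2])]

/-- ★★ **THE COST OF THE RUNG-FREE WALKS**: for `y, z > 0` and a bottom share `0 < a₀ < 1/2`, the joint rate at the tilt realising
`(a₀ − t, 1/2 − a₀ − t)` tends to `log μ_1(y,z) − a₀ log y − (1/2 − a₀) log z` as `t → 0⁺` (free energy minus the energy of walks spending the
fraction `2a₀` of their steps on the bottom wall and `1 − 2a₀` on the top wall, with no rungs and no entropy).
[cite: DemboZeitouni2010, §2.2 Theorem 2.2.3; JansevanRensburg2000, §3.2 Theorem 3.18 (1st ed., p. 51)] -/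
theorem tendsto_jointRate_adsorbedEdge (hy : 0 < y) (hz : 0 < z) {a₀ : ℝ} (ha0 : 0 < a₀) (ha1 : a₀ < 1 / 2) :
    Tendsto (fun t : ℝ => jointRate y z (eosY (a₀ - t) (1 / 2 - a₀ - t)) (eosY (1 / 2 - a₀ - t) (a₀ - t))) (𝓝[>] 0)
      (𝓝 (Real.log (stripMuY₂ 1 y z) - a₀ * Real.log y - (1 / 2 - a₀) * Real.log z)) := by
  have hs := tendsto_contactEntropy₂_adsorbedEdge ha0 ha1
  have ht : Tendsto (fun t : ℝ => t) (𝓝[>] (0 : ℝ)) (𝓝 0) := tendsto_nhdsWithin_of_tendsto_nhds tendsto_id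
  have hlin : Tendsto (fun t : ℝ => Real.log (stripMuY₂ 1 y z) -
      ((a₀ - t) * Real.log y + (1 / 2 - a₀ - t) * Real.log z + contactEntropy₂ (a₀ - t) (1 / 2 - a₀ - t))) (𝓝[>] 0)
      (𝓝 (Real.log (stripMuY₂ 1 y z) - ((a₀ - 0) * Real.log y + (1 / 2 - a₀ - 0) * Real.log z + 0))) :=
    tendsto_const_nhds.sub ((((tendsto_const_nhds.sub ht).mul tendsto_const_nhds).add
      ((tendsto_const_nhds.sub ht).mul tendsto_const_nhds)).add hs)
  have e : Real.log (stripMuY₂ 1 y z) - ((a₀ - 0) * Real.log y + (1 / 2 - a₀ - 0) * Real.log z + 0) =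
      Real.log (stripMuY₂ 1 y z) - a₀ * Real.log y - (1 / 2 - a₀) * Real.log z := by ring
  rw [e] at hlin
  refine hlin.congr' ?_
  have hev : ∀ᶠ t in 𝓝[>] (0 : ℝ), 0 < t ∧ t < min (2 * a₀) (1 - 2 * a₀) / 6 := by
    have : Set.Ioo (0 : ℝ) (min (2 * a₀) (1 - 2 * a₀) / 6) ∈ 𝓝[>] (0 : ℝ) :=
      Ioo_mem_nhdsGT (by have := lt_min (by linarith : 0 < 2 * a₀) (by linarith : 0 < 1 - 2 * a₀); linarith)
    filter_upwards [this] with t ht using ht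
  filter_upwards [hev] with t ht
  have hm1 : min (2 * a₀) (1 - 2 * a₀) ≤ 2 * a₀ := min_le_left _ _
  have hm2 : min (2 * a₀) (1 - 2 * a₀) ≤ 1 - 2 * a₀ := min_le_right _ _
  have k1 : (a₀ - t) + (1 / 2 - a₀ - t) < 1 / 2 := by linarith [ht.1]
  have k2 : 1 < 4 * (a₀ - t) + 2 * (1 / 2 - a₀ - t) := by linarith [ht.2]
  have k3 : 1 < 2 * (a₀ - t) + 4 * (1 / 2 - a₀ - t) := by linarith [ht.2]
  rw [jointRate_eq_sub_contactEntropy₂ hy hz k1 k2 k3]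

/-! ## §4 (ed.2) The repelling edge `4a + 2a' = 1`: a POSITIVE residual entropy, in closed form a binary entropy -/

/-- The closed form of the entropy near the repelling edge `4a + 2a' = 1`: for a top density `1/6 < c < 1/2` and small `t > 0`, at
`(a,a') = ((1−2c)/4 + t, c)` (bottom density `t` above its minimum given `c`), with `R = 3c − 1/2`, `S = 1/2 − c`, `A = (1−2c)/4 + t`:
`s = [½(log(R+2t) − 2 log(S−2t)) − A(log(R+2t) − log(2A) − 2 log(S−2t)) − c(2 log(R+2t) − log(2c) − 2 log(S−2t))] − 2t·log(4t)`.
[cite: JansevanRensburg2000, §3.2 Theorem 3.19 (1st ed., p. 52); BeatonBousquetMelouDeGierDuminilCopinGuttmann2014, §3.2 Proposition 6 (arXiv v5 p. 10)] -/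
theorem contactEntropy₂_repellingEdge_eq {c t : ℝ} (hc1 : 1 / 6 < c) (ht0 : 0 < t) (ht : 2 * t < 1 / 2 - c) :
    contactEntropy₂ ((1 - 2 * c) / 4 + t) c =
      (1 / 2 * (Real.log (3 * c - 1 / 2 + 2 * t) - 2 * Real.log (1 / 2 - c - 2 * t)) -
        ((1 - 2 * c) / 4 + t) * (Real.log (3 * c - 1 / 2 + 2 * t) - Real.log (2 * ((1 - 2 * c) / 4 + t)) -
          2 * Real.log (1 / 2 - c - 2 * t)) -
        c * (2 * Real.log (3 * c - 1 / 2 + 2 * t) - Real.log (2 * c) - 2 * Real.log (1 / 2 - c - 2 * t))) -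
      2 * t * Real.log (4 * t) := by
  have hR : 0 < 3 * c - 1 / 2 + 2 * t := by linarith
  have hS : 0 < 1 / 2 - c - 2 * t := by linarith
  have hA : 0 < (1 - 2 * c) / 4 + t := by linarith
  have hc0 : 0 < c := by linarith
  have k1 : ((1 - 2 * c) / 4 + t) + c < 1 / 2 := by linarith
  have k2 : 1 < 4 * ((1 - 2 * c) / 4 + t) + 2 * c := by linarith
  have k3 : 1 < 2 * ((1 - 2 * c) / 4 + t) + 4 * c := by linarith
  rw [contactEntropy₂_eq k1 k2 k3]
  have e1 : 4 * ((1 - 2 * c) / 4 + t) + 2 * c - 1 = 4 * t := by ring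
  have e2 : 2 * ((1 - 2 * c) / 4 + t) + 4 * c - 1 = 3 * c - 1 / 2 + 2 * t := by ring
  have e3 : 1 - 2 * ((1 - 2 * c) / 4 + t) - 2 * c = 1 / 2 - c - 2 * t := by ring
  have e1' : 4 * c + 2 * ((1 - 2 * c) / 4 + t) - 1 = 3 * c - 1 / 2 + 2 * t := by ring
  have e2' : 2 * c + 4 * ((1 - 2 * c) / 4 + t) - 1 = 4 * t := by ring
  have e3' : 1 - 2 * c - 2 * ((1 - 2 * c) / 4 + t) = 1 / 2 - c - 2 * t := by ring
  have hY : eosY ((1 - 2 * c) / 4 + t) c =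
      (4 * t) ^ 2 * (3 * c - 1 / 2 + 2 * t) / ((2 * ((1 - 2 * c) / 4 + t)) * (1 / 2 - c - 2 * t) ^ 2) := by
    unfold eosY; rw [e1, e2, e3]
  have hZ : eosY c ((1 - 2 * c) / 4 + t) =
      (3 * c - 1 / 2 + 2 * t) ^ 2 * (4 * t) / ((2 * c) * (1 / 2 - c - 2 * t) ^ 2) := by
    unfold eosY; rw [e1', e2', e3']
  rw [e1, e2, e3, hY, hZ]
  have h4t : 0 < 4 * t := by linarith
  have hlog0 : Real.log (4 * t * (3 * c - 1 / 2 + 2 * t) / (1 / 2 - c - 2 * t) ^ 2) =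
      Real.log (4 * t) + Real.log (3 * c - 1 / 2 + 2 * t) - 2 * Real.log (1 / 2 - c - 2 * t) := by
    rw [Real.log_div (by positivity) (by positivity), Real.log_mul h4t.ne' hR.ne', Real.log_pow]; push_cast; ring
  have hlogY : Real.log ((4 * t) ^ 2 * (3 * c - 1 / 2 + 2 * t) / ((2 * ((1 - 2 * c) / 4 + t)) * (1 / 2 - c - 2 * t) ^ 2)) =
      2 * Real.log (4 * t) + Real.log (3 * c - 1 / 2 + 2 * t) -
        (Real.log (2 * ((1 - 2 * c) / 4 + t)) + 2 * Real.log (1 / 2 - c - 2 * t)) := by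
    rw [Real.log_div (by positivity) (by positivity),
      Real.log_mul (x := (4 * t) ^ 2) (y := 3 * c - 1 / 2 + 2 * t) (by positivity) hR.ne', Real.log_pow,
      Real.log_mul (x := 2 * ((1 - 2 * c) / 4 + t)) (y := (1 / 2 - c - 2 * t) ^ 2) (by positivity) (by positivity),
      Real.log_pow]
    push_cast; ring
  have hlogZ : Real.log ((3 * c - 1 / 2 + 2 * t) ^ 2 * (4 * t) / ((2 * c) * (1 / 2 - c - 2 * t) ^ 2)) =
      2 * Real.log (3 * c - 1 / 2 + 2 * t) + Real.log (4 * t) - (Real.log (2 * c) + 2 * Real.log (1 / 2 - c - 2 * t)) := by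
    rw [Real.log_div (by positivity) (by positivity),
      Real.log_mul (x := (3 * c - 1 / 2 + 2 * t) ^ 2) (y := 4 * t) (by positivity) h4t.ne', Real.log_pow,
      Real.log_mul (x := 2 * c) (y := (1 / 2 - c - 2 * t) ^ 2) (by positivity) (by positivity), Real.log_pow]
    push_cast; ring
  rw [hlog0, hlogY, hlogZ]
  ring

/-- ★★ **THE RESIDUAL ENTROPY ON THE REPELLING EDGE IS A BINARY ENTROPY**: for every top density `1/6 < c < 1/2`, as the bottom density
decreases to its minimum `(1−2c)/4` given `c` (the edge `4a + 2a' = 1` of the triangle, along which `y/μ_1² → 0`),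
`s((1−2c)/4 + t, c) → L(c) := −(R/2)·log R − (S/2)·log S + c·log(2c)` with `R = 3c − 1/2`, `S = 1/2 − c` (`R + S = 2c`), i.e.
`L(c) = c·H(R/(2c))` with `H` the binary entropy in nats — POSITIVE on the open edge, `→ 0` at both ends (`c → 1/6`: the zigzag vertex;
`c → 1/2`: the top-adsorbed vertex).  Contrast: the entropy VANISHES on the adsorbed edge (§3).
[cite: JansevanRensburg2000, §3.3 (1st ed.: the density function at the endpoints of its support); DemboZeitouni2010, §2.2 Theorem 2.2.3] -/
theorem tendsto_contactEntropy₂_repellingEdge {c : ℝ} (hc1 : 1 / 6 < c) (hc2 : c < 1 / 2) :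
    Tendsto (fun t : ℝ => contactEntropy₂ ((1 - 2 * c) / 4 + t) c) (𝓝[>] 0)
      (𝓝 (-((3 * c - 1 / 2) / 2) * Real.log (3 * c - 1 / 2) - ((1 / 2 - c) / 2) * Real.log (1 / 2 - c) +
        c * Real.log (2 * c))) := by
  have hR0 : 3 * c - 1 / 2 + 2 * 0 ≠ 0 := by linarith
  have hS0 : 1 / 2 - c - 2 * 0 ≠ 0 := by linarith
  have hA0 : 2 * ((1 - 2 * c) / 4 + 0) ≠ 0 := by linarith
  have hR : ContinuousAt (fun t : ℝ => Real.log (3 * c - 1 / 2 + 2 * t)) 0 :=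
    (continuousAt_const.add (continuousAt_const.mul continuousAt_id)).log hR0
  have hS : ContinuousAt (fun t : ℝ => Real.log (1 / 2 - c - 2 * t)) 0 :=
    (continuousAt_const.sub (continuousAt_const.mul continuousAt_id)).log hS0
  have hAl : ContinuousAt (fun t : ℝ => (1 - 2 * c) / 4 + t) 0 := continuousAt_const.add continuousAt_id
  have hA : ContinuousAt (fun t : ℝ => Real.log (2 * ((1 - 2 * c) / 4 + t))) 0 := (continuousAt_const.mul hAl).log hA0
  have hg : ContinuousAt (fun t : ℝ =>
      1 / 2 * (Real.log (3 * c - 1 / 2 + 2 * t) - 2 * Real.log (1 / 2 - c - 2 * t)) -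
        ((1 - 2 * c) / 4 + t) * (Real.log (3 * c - 1 / 2 + 2 * t) - Real.log (2 * ((1 - 2 * c) / 4 + t)) -
          2 * Real.log (1 / 2 - c - 2 * t)) -
        c * (2 * Real.log (3 * c - 1 / 2 + 2 * t) - Real.log (2 * c) - 2 * Real.log (1 / 2 - c - 2 * t))) 0 :=
    ((continuousAt_const.mul (hR.sub (continuousAt_const.mul hS))).sub
        (hAl.mul ((hR.sub hA).sub (continuousAt_const.mul hS)))).sub
      (continuousAt_const.mul (((continuousAt_const.mul hR).sub continuousAt_const).sub (continuousAt_const.mul hS)))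
  have hg0 := hg.tendsto
  have v3 : Real.log (2 * ((1 - 2 * c) / 4 + 0)) = Real.log (1 / 2 - c) := by congr 1; ring
  have hval : (1 / 2 * (Real.log (3 * c - 1 / 2 + 2 * 0) - 2 * Real.log (1 / 2 - c - 2 * 0)) -
        ((1 - 2 * c) / 4 + 0) * (Real.log (3 * c - 1 / 2 + 2 * 0) - Real.log (2 * ((1 - 2 * c) / 4 + 0)) -
          2 * Real.log (1 / 2 - c - 2 * 0)) -
        c * (2 * Real.log (3 * c - 1 / 2 + 2 * 0) - Real.log (2 * c) - 2 * Real.log (1 / 2 - c - 2 * 0))) =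
      -((3 * c - 1 / 2) / 2) * Real.log (3 * c - 1 / 2) - ((1 / 2 - c) / 2) * Real.log (1 / 2 - c) + c * Real.log (2 * c) := by
    rw [v3, mul_zero, add_zero, sub_zero, add_zero]; ring
  rw [hval] at hg0
  -- the `t log(4t)` part
  have htl : Tendsto (fun t : ℝ => 2 * t * Real.log (4 * t)) (𝓝 0) (𝓝 0) := by
    have h4 : Continuous fun t : ℝ => 4 * t := continuous_const.mul continuous_id
    have h := ((Real.continuous_mul_log.comp h4).tendsto 0).const_mul (1 / 2 : ℝ)
    simp only [Function.comp, mul_zero, Real.log_zero] at h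
    refine h.congr fun t => ?_
    ring
  have hsum := Tendsto.mono_left (hg0.sub htl) (nhdsWithin_le_nhds (s := Set.Ioi (0 : ℝ)) (a := (0 : ℝ)))
  rw [sub_zero] at hsum
  refine hsum.congr' ?_
  have hev : ∀ᶠ t in 𝓝[>] (0 : ℝ), 0 < t ∧ t < (1 / 2 - c) / 2 := by
    have : Set.Ioo (0 : ℝ) ((1 / 2 - c) / 2) ∈ 𝓝[>] (0 : ℝ) := Ioo_mem_nhdsGT (by linarith)
    filter_upwards [this] with t ht using ht
  filter_upwards [hev] with t ht
  rw [contactEntropy₂_repellingEdge_eq hc1 ht.1 (by linarith [ht.2])]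

/-- ★ The limit on the repelling edge is POSITIVE: `L(c) > 0` for `1/6 < c < 1/2` — it is `−(R/2) log(R/2c) − (S/2) log(S/2c)` with
`R/2c, S/2c ∈ (0,1)` summing to `1`. [cite: DemboZeitouni2010, §2.2 (lane plumbing)] -/
theorem repellingEdge_limit_pos {c : ℝ} (hc1 : 1 / 6 < c) (hc2 : c < 1 / 2) :
    0 < -((3 * c - 1 / 2) / 2) * Real.log (3 * c - 1 / 2) - ((1 / 2 - c) / 2) * Real.log (1 / 2 - c) +
        c * Real.log (2 * c) := by
  have hR : 0 < 3 * c - 1 / 2 := by linarith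
  have hS : 0 < 1 / 2 - c := by linarith
  have hc : 0 < 2 * c := by linarith
  -- `log(R) < log(2c)` and `log(S) < log(2c)` since `R, S < 2c = R + S`
  have h1 : Real.log (3 * c - 1 / 2) < Real.log (2 * c) := Real.log_lt_log hR (by linarith)
  have h2 : Real.log (1 / 2 - c) < Real.log (2 * c) := Real.log_lt_log hS (by linarith)
  have e : c * Real.log (2 * c) = ((3 * c - 1 / 2) / 2) * Real.log (2 * c) + ((1 / 2 - c) / 2) * Real.log (2 * c) := by ring
  rw [e]
  nlinarith [mul_lt_mul_of_pos_left h1 (by linarith : 0 < (3 * c - 1 / 2) / 2),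
    mul_lt_mul_of_pos_left h2 (by linarith : 0 < (1 / 2 - c) / 2)]

end Literature.Probability.RandomPlanarGeometry.SAW.HexBW
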